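import Literature.NumberTheory.EllipticCurves.Rank1Residual.Typed.KimCertificate
import Literature.NumberTheory.EllipticCurves.Rank1Residual.Typed.X6
import HarnessLib

/-!
# Class X6, analytic rank `0`, `p ≥ 5` with `p ∣ #Ш_an`: `BSD(E,p)` per pair from ONE unit Kurihara
# number (Kim, Amer. J. Math. 2026, Thm. 1.8) — the X6 reading of the cell's class-agnostic consumer
# (cell `b2b-bsdres`, supersingular family, prover A = unit `b2b-bsdres-x10b`, gen 4)

HONEST FRAMING (run/shared/lean/b2b/bsd-rank1-residual/, verbatim in every file): the goal of the
cell is to DELETE the COMBINATION-SHAPED residual classes of the Birch–Swinnerton-Dyer formula for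
ALL analytic-rank `≤ 1` elliptic curves over `ℚ` — "full BSD formula for every rank `≤ 1` curve in
class `C`" assembled STRICTLY from published theorems — so that the rank-`≤ 1` remainder becomes
exactly the CONSTRUCTION-SHAPED classes, which are TYPED (missing-input `Prop`s), NOT attempted.
This is not "finishing BSD". THEOREMS ONLY; per pair; NOT a class theorem; X6 stays
CONSTRUCTION-SHAPED; nothing is booked here (the lane books pairs: two engines + referee).

## What this file does (X6-ROUTE.md §3 (b), HOME/b2b-bsdres-x10b/)

The per-pair X6 residue in analytic rank `0` consists of the pairs with `p ∣ #Ш_an` (the lower bound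
is vacuous otherwise). At `p ≥ 5` the tree already holds a PUBLISHED, certificate-driven route that is
blind to the reduction type at `p` as long as it is good or multiplicative: C.-H. Kim, Amer. J. Math.
148 (2026) Thm. 1.8 clause (6) (named fact `Kim2022_rankZero_padicValRat_sha_of_kuriharaNumber_ne_zero`,
file `KuriharaNumberKimShaLength`; consumer `Typed.bsdp_of_kim_rankZero_of_kuriharaNumber_ne_zero`,
file `Typed/KimCertificate`, written for X11 by prover x11a): ONE Kurihara number `δ̃_n ≢ 0 (mod p)` at a
Kolyvagin level `n` with cyclic reductions gives `ord_p #Ш = ord_p(L(E,1)/Ω_E)`, hence `BSD(E,p)` when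
`p ∤ ∏ c_ℓ · #E(ℚ)_tors`. On class X6 (`ss(p) ∧ sst ∧ (p ≥ 5 ∨ a_3 = 0)`) at `p ≥ 5` EVERY side
condition except `p ∤ ∏ c_ℓ` and the certificate is automatic: good reduction at `p` (class),
`ρ̄_{E,p}` onto (`ClassX6.surj`, Serre Props. 12 + 21 i)), `p ∤ #E(ℚ)_tors` (`ClassX6.irr`), and the
period transfer `Ω(W) = u·Ω⁺_f`, `|u|_p = 1` (named fact `realPeriodRat_eq_unit_mul_plusPeriod`:
Greenberg–Vatsal 2000 Rem. 3.4 + Mazur 1978 Cor. 4.1 + Edixhoven, good `p ≥ 5`, `E[p]` irreducible).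

* `X6.bsdp_of_kim_rankZero_of_kuriharaNumber_ne_zero` — X6 ∧ `r_an = 0` ∧ `p ≥ 5` ∧ `p ∤ ∏ c_ℓ` +
  certificate `(n, ψ, δ̃_n ≢ 0)` ⇒ `BSDp W p`, inputs Kim Thm. 1.8 (`hKim`), the period fact (`hϖ`),
  GZK, modularity — all PUBLISHED, by name.

Where it bites (census N < 2·10⁴, X6-ROUTE §1): the three X6 rank-0 pairs with `p ≥ 5`, `p ∣ #Ш_an`
— 11998a1@5 (`∏c = 8`), 15953a1@5 (`∏c = 4`), 12927e1@7 (`∏c = 2`); the kurihara lane's sweep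
(run/shared/lean/speedrun/kurihara/out/, impl-1) has `δ_{61·271} ≡ 3 (mod 5)` for 11998a1 and
`δ_{113·421} ≡ 4 (mod 7)` for 12927e1 (both already visibility-certified, `X6VisibilityRecords`, so this
is a SECOND independent route), and only zeros among three tried levels for 15953a1 (mop-up job
j089942 of this seat). Cyclicity at each `ℓ ∣ n` and the second engine are for the lane/referee.

References: Kim 2026 [Kim2022StructureSelmer] Thm. 1.8 (6), Cor. 1.6, §1.3.5; Greenberg–Vatsal 2000
Rem. 3.4 [GreenbergVatsal2000]; Mazur 1978 Cor. 4.1 [Mazur1978]; Serre 1972 Props. 12, 21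
[Serre1972]; Miller 2011 Def. 1.1 [Miller2011LMS].
-/

set_option autoImplicit false

noncomputable section

open scoped Classical MatrixGroups ModularForm

open CongruenceSubgroup WeierstrassCurve Literature.NumberTheory.EllipticCurves
  Literature.NumberTheory.EllipticCurves.ModularForms
  Literature.NumberTheory.EllipticCurves.Rank1Residual
  Literature.NumberTheory.EllipticCurves.Rank1Residual.Typed

namespace Summit.BirchSwinnertonDyer.Rank1Residual.Supersingular

variable (W : WeierstrassCurve ℚ) [W.IsElliptic] [W.IsGloballyMinimal] (p : ℕ) [Fact p.Prime]

/-- **X6 ∧ `r_an = 0` ∧ `p ≥ 5`: `BSD(E,p)` from PUBLISHED theorems plus ONE Kurihara-number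
certificate.** On class X6 at a prime `p ≥ 5` in analytic rank `0` with `p ∤ ∏_ℓ c_ℓ`: Kim 2026
Thm. 1.8 (6) (`hKim`), the good-prime period transfer (`hϖ`, Greenberg–Vatsal Rem. 3.4 + Mazur
Cor. 4.1), GZK (`hGZK`) and modularity (`hmod`), together with the per-pair CERTIFICATE — a Kolyvagin
level `n ∈ 𝒩_1` (`ℓ ∤ Np`, `ℓ ≡ 1`, `a_ℓ ≡ ℓ + 1 (mod p)`) with cyclic `p`-parts `#Ẽ(𝔽_ℓ)[p] ≤ p`,
surjective discrete logarithms `ψ_ℓ`, and `kuriharaNumber f p n ψ ≠ 0` (`δ̃_n ≢ 0 (mod p)`) — give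
Miller's `BSDp W p`. Good reduction, `ρ̄_{E,p}` onto (`ClassX6.surj`) and `p ∤ #E(ℚ)_tors`
(`ClassX6.irr`) are automatic on X6. Per pair; NOT a class theorem.
[cite: Kim2022StructureSelmer, Thm. 1.9 (6) (PDF p. 8), Cor. 1.6] [cite: GreenbergVatsal2000, §3, Remark 3.4]
[cite: Serre1972, §5.4 Prop. 21 i)] [cite: Miller2011LMS, Def. 1.1] -/
theorem X6.bsdp_of_kim_rankZero_of_kuriharaNumber_ne_zero
    (hKim : Kim2022_rankZero_padicValRat_sha_of_kuriharaNumber_ne_zero)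
    (hϖ : realPeriodRat_eq_unit_mul_plusPeriod)
    (hGZK : rank_eq_analyticRank_of_analyticRank_le_one) (hmod : hasEntireLFunction_rat)
    (hp : 5 ≤ p) (hX : ClassX6 W p) (hr : W.analyticRank = 0) (htam : ¬ p ∣ W.tamagawaProduct)
    {N : ℕ} [NeZero N] (f : CuspForm (Gamma0 N) 2) (hf : IsNewformOf W f)
    (n : ℕ) [NeZero n] (hn : Kato.IsKolyvaginProduct W p 1 n)
    (hcyc : ∀ (ℓ : ℕ) [Fact ℓ.Prime], ℓ ∣ n →
      Nat.card {P : ((WeierstrassCurve.integralModelInt W).map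
          (Int.castRingHom (ZMod ℓ))).toAffine.Point // p • P = 0} ≤ p)
    (ψ : (ℓ : ℕ) → (ZMod ℓ)ˣ →* Multiplicative (ZMod (p ^ 1)))
    (hψ : ∀ ℓ ∈ n.primeFactors, Function.Surjective (ψ ℓ))
    (hδ : kuriharaNumber f (p ^ 1) n ψ ≠ 0) : BSDp W p := by
  have hp2 : p ≠ 2 := by omega
  have hirr : W.HasIrreducibleModPGaloisRep p := ClassX6.irr W p hp2 hX
  have htors : ¬ p ∣ W.torsionOrder := by
    intro hdvd
    have h0 := padicValNat_torsionOrder_eq_zero_of_irreducible W p hirr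
    have hpos : 0 < W.torsionOrder := W.torsionOrder_pos_holds
    have : 1 ≤ padicValNat p W.torsionOrder :=
      one_le_padicValNat_of_dvd hpos.ne' hdvd
    omega
  exact Typed.bsdp_of_kim_rankZero_of_kuriharaNumber_ne_zero W p hKim hGZK hp (Or.inl hX.1.1)
    (ClassX6.surj W p hp2 hX) ((W.analyticRank_eq_zero_iff_holds (hmod W)).mp hr) htam htors f hf
    (hϖ W p hp hX.1.1 hirr f hf) n hn hcyc ψ hψ hδ

end Summit.BirchSwinnertonDyer.Rank1Residual.Supersingular

end
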